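import Mathlib.GroupTheory.Perm.Fin
import Mathlib.GroupTheory.Perm.Sign
import HarnessLib

/-!
# The Coxeter presentation of the symmetric group (universal property)

Topic `Literature/RepresentationTheory/FiniteGroups`. Support for `KLRGradedCellularBasis.lean`
(Brundan–Kleshchev's inverse map `k[S_n] → R^{Λ₀}_n` is defined on the Coxeter generators).

**Theorem (Moore 1897; Björner–Brenti, *Combinatorics of Coxeter groups*, Prop. 1.5.4: `(S_n, S)` is a
Coxeter system of type `A_{n-1}`, i.e. `S_n = ⟨s_1, …, s_{n-1} | s_i² = 1, (s_is_{i+1})³ = 1,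
(s_is_j)² = 1 (|i-j|>1)⟩`).** Let `M` be a monoid and `σ_0, …, σ_{n-2} ∈ M` satisfy
`σ_r² = 1`, `σ_rσ_{r+1}σ_r = σ_{r+1}σ_rσ_{r+1}` and `σ_rσ_t = σ_tσ_r` (`|r - t| > 1`). Then there is a
unique monoid homomorphism `S_n → M` with `(r, r+1) ↦ σ_r` (`permFinLift`, `permFinLift_adjSwap`,
`permFinLift_unique`).

The proof is the classical normal-form induction on `n`: every `w ∈ S_{n+1}` is uniquely
`w = d_j w'` with `j = w(0)`, `d_j = s_{j-1} ⋯ s_1 s_0` and `w' ∈ Stab(0) = S_n`, and left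
multiplication by a generator `s_r` acts on normal forms by the four rules
`s_r d_j = d_j s_r` (`r > j`), `= d_{j+1}` (`r = j`), `= d_{j-1}` (`r = j - 1`), `= d_j s_{r+1}`
(`r < j - 1`), which hold verbatim for the `σ`'s.

## References

* A. Björner, F. Brenti, *Combinatorics of Coxeter groups*, GTM 231, Springer 2005, §1.5,
  Prop. 1.5.4 (book p. 23). [BjornerBrenti2005]
-/

namespace Literature.RepresentationTheory.FiniteGroups

open Equiv

/-- The adjacent transposition `s_r = (r, r+1)` of `Fin n` (`1` if `r + 1 ≥ n`). [folklore] -/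
def adjSwap (n r : ℕ) : Perm (Fin n) :=
  if h : r + 1 < n then swap (⟨r, by omega⟩ : Fin n) ⟨r + 1, h⟩ else 1

/-- `s_r = (r, r+1)` when `r + 1 < n`. [folklore] -/
theorem adjSwap_of_lt {n r : ℕ} (h : r + 1 < n) :
    adjSwap n r = swap (⟨r, by omega⟩ : Fin n) ⟨r + 1, h⟩ := dif_pos h

/-- `s_r = 1` when `r + 1 ≥ n`. [folklore] -/
theorem adjSwap_of_le {n r : ℕ} (h : n ≤ r + 1) : adjSwap n r = 1 := dif_neg (not_lt.2 h)

/-- `s_r(x)` on values. [folklore] -/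
theorem adjSwap_apply_val {n r : ℕ} (h : r + 1 < n) (x : Fin n) :
    ((adjSwap n r x : Fin n) : ℕ) = if (x : ℕ) = r then r + 1 else if (x : ℕ) = r + 1 then r else x := by
  rw [adjSwap_of_lt h, swap_apply_def]
  split_ifs with h1 h2 h3 h4 h5 <;> simp_all [Fin.ext_iff]

section Relations

variable {M : Type*} [Monoid M]

/-- **The Coxeter relations of type `A_{n-1}`** for `σ_0, …, σ_{n-2}` (a sequence `σ : ℕ → M`;
only the indices `r` with `r + 1 < n` matter). [cite: BjornerBrenti2005, Prop 1.5.4] -/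
structure IsCoxeterDataA (n : ℕ) (σ : ℕ → M) : Prop where
  sq : ∀ r, r + 1 < n → σ r * σ r = 1
  braid : ∀ r, r + 2 < n → σ r * σ (r + 1) * σ r = σ (r + 1) * σ r * σ (r + 1)
  comm : ∀ r t, t + 1 < n → r + 1 < t → σ r * σ t = σ t * σ r

/-- Shifting the generators: the data for `Stab(0) ≅ S_{n}` inside `S_{n+1}`. [folklore] -/
theorem IsCoxeterDataA.shift {n : ℕ} {σ : ℕ → M} (h : IsCoxeterDataA (n + 1) σ) :
    IsCoxeterDataA n fun t => σ (t + 1) where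
  sq r hr := h.sq (r + 1) (by omega)
  braid r hr := h.braid (r + 1) (by omega)
  comm r t ht hrt := h.comm (r + 1) (t + 1) (by omega) (by omega)

/-- `δ_j = σ_{j-1} ⋯ σ_1 σ_0`. [folklore] -/
def coxD (σ : ℕ → M) : ℕ → M
  | 0 => 1
  | j + 1 => σ j * coxD σ j

/-- `δ_0 = 1`. [folklore] -/
@[simp] theorem coxD_zero (σ : ℕ → M) : coxD σ 0 = 1 := rfl

/-- `δ_{j+1} = σ_j δ_j`. [folklore] -/
theorem coxD_succ (σ : ℕ → M) (j : ℕ) : coxD σ (j + 1) = σ j * coxD σ j := rfl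

/-- Rule 1: `σ_r δ_j = δ_j σ_r` for `r > j`. [folklore] -/
theorem IsCoxeterDataA.mul_coxD_of_lt {n : ℕ} {σ : ℕ → M} (h : IsCoxeterDataA n σ) {r j : ℕ}
    (hr : r + 1 < n) (hj : j < r) : σ r * coxD σ j = coxD σ j * σ r := by
  induction j with
  | zero => rw [coxD_zero, mul_one, one_mul]
  | succ j ih =>
    rw [coxD_succ, ← mul_assoc, ← h.comm j r hr (by omega), mul_assoc, ih (by omega), mul_assoc]

/-- Rule 3: `σ_j δ_{j+1} = δ_j`. [folklore] -/
theorem IsCoxeterDataA.mul_coxD_succ_self {n : ℕ} {σ : ℕ → M} (h : IsCoxeterDataA n σ) {j : ℕ}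
    (hj : j + 1 < n) : σ j * coxD σ (j + 1) = coxD σ j := by
  rw [coxD_succ, ← mul_assoc, h.sq j hj, one_mul]

/-- Rule 4: `σ_r δ_j = δ_j σ_{r+1}` for `r + 1 < j` (`j ≤ n - 1`). [folklore] -/
theorem IsCoxeterDataA.mul_coxD_of_succ_lt {n : ℕ} {σ : ℕ → M} (h : IsCoxeterDataA n σ) {r j : ℕ}
    (hj : j < n) (hrj : r + 1 < j) : σ r * coxD σ j = coxD σ j * σ (r + 1) := by
  induction j with
  | zero => omega
  | succ j ih =>
    rcases Nat.lt_or_ge (r + 1) j with hlt | hge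
    · rw [coxD_succ, ← mul_assoc, h.comm r j (by omega) hlt, mul_assoc, ih (by omega) hlt, mul_assoc]
    · have hj' : j = r + 1 := by omega
      subst hj'
      rw [coxD_succ, coxD_succ, ← mul_assoc, ← mul_assoc, h.braid r (by omega), mul_assoc, mul_assoc,
        h.mul_coxD_of_lt (by omega) (Nat.lt_succ_self r), ← mul_assoc, ← mul_assoc, ← mul_assoc]

end Relations

/-! ### The symmetric group side -/

/-- `S_n`'s adjacent transpositions satisfy the Coxeter relations. [folklore] -/
theorem isCoxeterDataA_adjSwap (n : ℕ) : IsCoxeterDataA n (adjSwap n) where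
  sq r hr := by rw [adjSwap_of_lt hr, swap_mul_self]
  braid r hr := by
    ext x
    simp only [Perm.coe_mul, Function.comp_apply]
    have e1 := adjSwap_apply_val (n := n) (r := r) (by omega)
    have e2 := adjSwap_apply_val (n := n) (r := r + 1) hr
    simp only [e1, e2]
    split_ifs <;> omega
  comm r t ht hrt := by
    ext x
    simp only [Perm.coe_mul, Function.comp_apply]
    have e1 := adjSwap_apply_val (n := n) (r := r) (by omega)
    have e2 := adjSwap_apply_val (n := n) (r := t) ht
    simp only [e1, e2]
    split_ifs <;> omega

/-- `Stab(0) ≅ S_n ↪ S_{n+1}`, `e ↦ (0 ↦ 0, x+1 ↦ e(x)+1)`. [folklore] -/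
def finSuccExt (n : ℕ) : Perm (Fin n) →* Perm (Fin (n + 1)) where
  toFun e := Perm.decomposeFin.symm (0, e)
  map_one' := by rw [Perm.decomposeFin_symm_of_one, swap_self]; rfl
  map_mul' a b := by
    ext x
    refine Fin.cases ?_ (fun y => ?_) x
    · simp [Perm.decomposeFin_symm_apply_zero]
    · simp [Perm.decomposeFin_symm_apply_succ, swap_self]

/-- `ext(e)(0) = 0`. [folklore] -/
theorem finSuccExt_apply_zero {n : ℕ} (e : Perm (Fin n)) : finSuccExt n e 0 = 0 :=
  Perm.decomposeFin_symm_apply_zero 0 e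

/-- `ext(e)(y+1) = e(y)+1`. [folklore] -/
theorem finSuccExt_apply_succ {n : ℕ} (e : Perm (Fin n)) (y : Fin n) :
    finSuccExt n e y.succ = (e y).succ := by
  show Perm.decomposeFin.symm (0, e) y.succ = (e y).succ
  rw [Perm.decomposeFin_symm_apply_succ, swap_self]; rfl

/-- `ext` is injective. [folklore] -/
theorem finSuccExt_injective (n : ℕ) : Function.Injective (finSuccExt n) := by
  intro a b h
  have := Perm.decomposeFin.symm.injective (h : Perm.decomposeFin.symm (0, a) = Perm.decomposeFin.symm (0, b))
  simpa using this

/-- A permutation fixing `0` comes from `S_n`. [folklore] -/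
theorem eq_finSuccExt_of_apply_zero {n : ℕ} {v : Perm (Fin (n + 1))} (hv : v 0 = 0) :
    v = finSuccExt n (Perm.decomposeFin v).2 := by
  have h := Perm.decomposeFin.symm_apply_apply v
  have h1 : (Perm.decomposeFin v).1 = 0 := by
    have := Perm.decomposeFin_symm_apply_zero (Perm.decomposeFin v).1 (Perm.decomposeFin v).2
    rw [Prod.mk.eta, h] at this
    rw [← this, hv]
  conv_lhs => rw [← h, ← Prod.mk.eta (p := Perm.decomposeFin v), h1]
  rfl

/-- `ext(s_t) = s_{t+1}`. [folklore] -/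
theorem finSuccExt_adjSwap (n t : ℕ) : finSuccExt n (adjSwap n t) = adjSwap (n + 1) (t + 1) := by
  ext x
  refine Fin.cases ?_ (fun y => ?_) x
  · rw [finSuccExt_apply_zero]
    by_cases h : t + 2 < n + 1
    · have := adjSwap_apply_val (n := n + 1) (r := t + 1) h 0
      simp only [Fin.val_zero] at this
      rw [Fin.val_zero, this]; simp
    · rw [adjSwap_of_le (not_lt.1 h)]; rfl
  · rw [finSuccExt_apply_succ]
    by_cases h : t + 1 < n
    · have e1 := adjSwap_apply_val (n := n) (r := t) h y
      have e2 := adjSwap_apply_val (n := n + 1) (r := t + 1) (by omega) y.succ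
      simp only [Fin.val_succ] at e2 ⊢
      rw [e1, e2]
      split_ifs <;> omega
    · rw [adjSwap_of_le (not_lt.1 h), adjSwap_of_le (by omega)]; rfl

/-- The coset representatives `d_j = s_{j-1} ⋯ s_0 ∈ S_{n+1}` (`d_j(0) = j`). [folklore] -/
abbrev coxDPerm (n : ℕ) : ℕ → Perm (Fin (n + 1)) := coxD (adjSwap (n + 1))

/-- `d_j(0) = j`. [folklore] -/
theorem coxDPerm_apply_zero {n j : ℕ} (hj : j < n + 1) : ((coxDPerm n j 0 : Fin (n + 1)) : ℕ) = j := by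
  induction j with
  | zero => rfl
  | succ j ih =>
    rw [coxDPerm, coxD_succ, Perm.mul_apply, adjSwap_apply_val hj, ih (by omega), if_pos rfl]

/-- The `S_n`-part of the normal form `w = d_{w(0)} · ext(rest w)`. [folklore] -/
noncomputable def coxRest {n : ℕ} (w : Perm (Fin (n + 1))) : Perm (Fin n) :=
  (Perm.decomposeFin ((coxDPerm n (w 0 : ℕ))⁻¹ * w)).2

/-- **Normal form** `w = d_{w(0)} · ext(rest w)`. [folklore] -/
theorem coxDPerm_mul_finSuccExt_coxRest {n : ℕ} (w : Perm (Fin (n + 1))) :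
    coxDPerm n (w 0 : ℕ) * finSuccExt n (coxRest w) = w := by
  have h0 : ((coxDPerm n (w 0 : ℕ))⁻¹ * w) 0 = 0 := by
    rw [Perm.mul_apply, Perm.inv_eq_iff_eq]
    exact Fin.ext (coxDPerm_apply_zero (w 0).2).symm
  have := eq_finSuccExt_of_apply_zero h0
  rw [coxRest, ← this, mul_inv_cancel_left]

/-- **Uniqueness of the normal form.** [folklore] -/
theorem coxDPerm_mul_finSuccExt_inj {n j j' : ℕ} (hj : j < n + 1) (hj' : j' < n + 1)
    {a b : Perm (Fin n)} (h : coxDPerm n j * finSuccExt n a = coxDPerm n j' * finSuccExt n b) :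
    j = j' ∧ a = b := by
  have h0 := congrArg (fun v : Perm (Fin (n + 1)) => ((v 0 : Fin (n + 1)) : ℕ)) h
  simp only [Perm.mul_apply, finSuccExt_apply_zero, coxDPerm_apply_zero hj, coxDPerm_apply_zero hj'] at h0
  subst h0
  exact ⟨rfl, finSuccExt_injective n (mul_left_cancel h)⟩

/-- The normal form of `w` determines `rest w`. [folklore] -/
theorem coxRest_eq_of_eq {n j : ℕ} (hj : j < n + 1) {w : Perm (Fin (n + 1))} {a : Perm (Fin n)}
    (h : w = coxDPerm n j * finSuccExt n a) : ((w 0 : Fin (n + 1)) : ℕ) = j ∧ coxRest w = a := by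
  have h2 := coxDPerm_mul_finSuccExt_coxRest w
  rw [h] at h2 ⊢
  have := coxDPerm_mul_finSuccExt_inj (Fin.is_lt _) hj h2
  exact this

section Lift

variable {M : Type*} [Monoid M]

/-- The lift on elements, by the normal-form recursion `φ(d_j w') = δ_j φ'(w')`. [folklore] -/
noncomputable def permFinLiftFun : (n : ℕ) → (ℕ → M) → Perm (Fin n) → M
  | 0, _, _ => 1
  | n + 1, σ, w => coxD σ (w 0 : ℕ) * permFinLiftFun n (fun t => σ (t + 1)) (coxRest w)

/-- Unfolding of the recursion. [folklore] -/
theorem permFinLiftFun_succ (n : ℕ) (σ : ℕ → M) (w : Perm (Fin (n + 1))) :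
    permFinLiftFun (n + 1) σ w = coxD σ (w 0 : ℕ) * permFinLiftFun n (fun t => σ (t + 1)) (coxRest w) :=
  rfl

/-- **Key lemma**: `φ(1) = 1` and `φ(s_r w) = σ_r φ(w)`. [folklore] -/
theorem permFinLiftFun_spec (n : ℕ) (σ : ℕ → M) (hS : IsCoxeterDataA n σ) :
    permFinLiftFun n σ 1 = 1 ∧
      ∀ r, r + 1 < n → ∀ w, permFinLiftFun n σ (adjSwap n r * w) = σ r * permFinLiftFun n σ w := by
  induction n generalizing σ with
  | zero => exact ⟨rfl, fun r hr => by omega⟩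
  | succ n ih =>
    obtain ⟨ih1, ih2⟩ := ih (fun t => σ (t + 1)) hS.shift
    have hP := isCoxeterDataA_adjSwap (n + 1)
    -- normal form of `1`
    have hrest1 : ((1 : Perm (Fin (n + 1))) 0 : ℕ) = 0 ∧ coxRest (1 : Perm (Fin (n + 1))) = 1 :=
      coxRest_eq_of_eq (Nat.succ_pos n) (by rw [map_one, mul_one]; rfl)
    refine ⟨by rw [permFinLiftFun_succ, hrest1.1, hrest1.2, coxD_zero, one_mul, ih1], ?_⟩
    intro r hr w
    have hw := coxDPerm_mul_finSuccExt_coxRest w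
    set j : ℕ := (w 0 : ℕ) with hjdef
    have hj : j < n + 1 := (w 0).2
    set a := coxRest w
    rw [permFinLiftFun_succ, permFinLiftFun_succ]
    rcases Nat.lt_or_ge j r with hjr | hrj
    · -- Rule 1: `s_r d_j = d_j s_r`, `s_r = ext(s'_{r-1})`
      obtain ⟨r', rfl⟩ : ∃ r', r = r' + 1 := ⟨r - 1, by omega⟩
      have key : adjSwap (n + 1) (r' + 1) * w = coxDPerm n j * finSuccExt n (adjSwap n r' * a) := by
        conv_lhs => rw [← hw]
        rw [← mul_assoc, show adjSwap (n + 1) (r' + 1) * coxDPerm n j = coxDPerm n j * adjSwap (n + 1) (r' + 1)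
          from hP.mul_coxD_of_lt hr hjr, mul_assoc, map_mul, finSuccExt_adjSwap]
      obtain ⟨e1, e2⟩ := coxRest_eq_of_eq hj key
      rw [e1, e2, ih2 r' (by omega), ← mul_assoc, ← mul_assoc, hS.mul_coxD_of_lt hr hjr]
    · rcases Nat.lt_or_ge r j with hrj' | hjr'
      · rcases Nat.lt_or_ge (r + 1) j with hlt | hge
        · -- Rule 4: `s_r d_j = d_j s_{r+1}`, `s_{r+1} = ext(s'_r)`
          have key : adjSwap (n + 1) r * w = coxDPerm n j * finSuccExt n (adjSwap n r * a) := by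
            conv_lhs => rw [← hw]
            rw [← mul_assoc, show adjSwap (n + 1) r * coxDPerm n j = coxDPerm n j * adjSwap (n + 1) (r + 1)
              from hP.mul_coxD_of_succ_lt hj hlt, mul_assoc, map_mul, finSuccExt_adjSwap]
          obtain ⟨e1, e2⟩ := coxRest_eq_of_eq hj key
          rw [e1, e2, ih2 r (by omega), ← mul_assoc, ← mul_assoc, hS.mul_coxD_of_succ_lt hj hlt]
        · -- Rule 3: `j = r + 1`, `s_r d_{r+1} = d_r`
          have hjr : j = r + 1 := by omega
          have key : adjSwap (n + 1) r * w = coxDPerm n r * finSuccExt n a := by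
            conv_lhs => rw [← hw]
            rw [← mul_assoc, hjr, show adjSwap (n + 1) r * coxDPerm n (r + 1) = coxDPerm n r
              from hP.mul_coxD_succ_self hr]
          obtain ⟨e1, e2⟩ := coxRest_eq_of_eq (by omega) key
          rw [e1, e2, show ((w 0 : Fin (n + 1)) : ℕ) = r + 1 from hjr, ← mul_assoc,
            hS.mul_coxD_succ_self hr]
      · -- Rule 2: `j = r`, `s_r d_r = d_{r+1}`
        have hjr : j = r := le_antisymm hjr' hrj
        have key : adjSwap (n + 1) r * w = coxDPerm n (r + 1) * finSuccExt n a := by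
          conv_lhs => rw [← hw]
          rw [← mul_assoc, hjr]
          rfl
        obtain ⟨e1, e2⟩ := coxRest_eq_of_eq hr key
        rw [e1, e2, show ((w 0 : Fin (n + 1)) : ℕ) = r from hjr, ← mul_assoc, coxD_succ]

/-- `swap i.castSucc i.succ = s_i`. [folklore] -/
theorem swap_castSucc_succ_eq_adjSwap {m : ℕ} (i : Fin m) : swap i.castSucc i.succ = adjSwap (m + 1) i :=
  have h : (i : ℕ) + 1 < m + 1 := by have := i.2; omega
  ((adjSwap_of_lt (n := m + 1) (r := i) h).trans
    (congrArg₂ swap (Fin.ext rfl : (⟨(i : ℕ), by omega⟩ : Fin (m + 1)) = i.castSucc)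
      (Fin.ext rfl : (⟨(i : ℕ) + 1, h⟩ : Fin (m + 1)) = i.succ))).symm

/-- **The universal property of `S_n` as a Coxeter group of type `A_{n-1}` (existence)**: the monoid
homomorphism `S_n → M` with `(r, r+1) ↦ σ_r`. [cite: BjornerBrenti2005, Prop 1.5.4] -/
noncomputable def permFinLift {n : ℕ} {σ : ℕ → M} (hS : IsCoxeterDataA n σ) : Perm (Fin n) →* M where
  toFun := permFinLiftFun n σ
  map_one' := (permFinLiftFun_spec n σ hS).1
  map_mul' u v := by
    cases n with
    | zero => exact (one_mul _).symm
    | succ m =>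
      have hu : u ∈ Submonoid.closure (Set.range fun i : Fin m => swap i.castSucc i.succ) := by
        rw [Equiv.Perm.mclosure_swap_castSucc_succ m]; exact Submonoid.mem_top u
      induction hu using Submonoid.closure_induction_left with
      | one => rw [one_mul, (permFinLiftFun_spec _ σ hS).1, one_mul]
      | mul_left x hx y _ ih =>
        obtain ⟨i, rfl⟩ := hx
        beta_reduce
        rw [swap_castSucc_succ_eq_adjSwap, mul_assoc,
          (permFinLiftFun_spec _ σ hS).2 i (by have := i.2; omega),
          (permFinLiftFun_spec _ σ hS).2 i (by have := i.2; omega), ih, mul_assoc]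

/-- `φ(s_r) = σ_r`. [folklore] -/
theorem permFinLift_adjSwap {n : ℕ} {σ : ℕ → M} (hS : IsCoxeterDataA n σ) {r : ℕ} (hr : r + 1 < n) :
    permFinLift hS (adjSwap n r) = σ r := by
  have := (permFinLiftFun_spec n σ hS).2 r hr 1
  rw [mul_one, (permFinLiftFun_spec n σ hS).1, mul_one] at this
  exact this

/-- `φ((r, r+1)) = σ_r`, `Fin`-indexed form. [folklore] -/
theorem permFinLift_swap {n : ℕ} {σ : ℕ → M} (hS : IsCoxeterDataA n σ) {r r' : Fin n}
    (h : (r' : ℕ) = r + 1) : permFinLift hS (swap r r') = σ r := by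
  have hr : (r : ℕ) + 1 < n := h ▸ r'.2
  rw [← permFinLift_adjSwap hS hr, adjSwap_of_lt hr, show (⟨(r : ℕ), by omega⟩ : Fin n) = r from
    Fin.ext rfl, show (⟨(r : ℕ) + 1, hr⟩ : Fin n) = r' from Fin.ext h.symm]

/-- **Uniqueness**: a homomorphism `S_n → M` is determined by the images of the `(r, r+1)`.
[cite: BjornerBrenti2005, Prop 1.5.4] -/
theorem permFin_hom_ext {n : ℕ} {f g : Perm (Fin n) →* M}
    (h : ∀ r : ℕ, r + 1 < n → f (adjSwap n r) = g (adjSwap n r)) : f = g := by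
  cases n with
  | zero => ext w; rw [Subsingleton.elim w 1, map_one, map_one]
  | succ m =>
    refine MonoidHom.eq_of_eqOn_denseM (Equiv.Perm.mclosure_swap_castSucc_succ m) ?_
    rintro _ ⟨i, rfl⟩
    beta_reduce
    rw [swap_castSucc_succ_eq_adjSwap]
    exact h i (by have := i.2; omega)

end Lift

end Literature.RepresentationTheory.FiniteGroups
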